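import Summits.BirchSwinnertonDyer.BirchSwinnertonDyer.Theses.KolyvaginRankRigidityAtTwo
import HarnessLib

/-!
# Crux V2♭ `KolyvaginCorankLowerBoundAtTwo` (stmt-BirchSwinnertonDyer-24623), line `kolyvagin_depth_split`:
# Kolyvagin's WINDOW INDUCTION — the registered research stub T5 `stub_windowSupply` follows from
# (T5a) strong non-vanishing at the minimal depth and (T5b) the one-prime window step

Kolyvagin 1991 (Math. Ann. 291), proof of Thm. 2.2: "Let `η'_1 = p_0 p'_1 … p'_f` be such that
`m(η'_1) = m_f`. By means of [1, Proposition 8] we can, by induction, replace `p'_1, …, p'_f` by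
`p_1, …, p_f` such that `η_1 = p_0 … p_f ∈ Λ^f_{n'}` and `m(η_1) = m_f`. Then we again use
[1, Proposition 8] (which is true for `r = k` as well) and by induction find a suitable `η_i`."
This file makes that induction formal and ABSTRACT, and derives the line's registered stub
`stub_windowSupply` (T5: `ν + 1` depth-`ν` conductors `n_i = ∏ S_i` on Kolyvagin primes of index
`≥ M + 1`, test primes `q_j ∈ S_i` for `j < i`, places `v_i ∋ q_i`, and large local order of
`c_M(n_i)` at `v_i`) from two statements closer to Kolyvagin's Prop. 8:

* (T5a) STRONG NON-VANISHING at the minimal depth `ν`: for one defect `d₀` and every level `M`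
  a depth-`ν` conductor on Kolyvagin primes of index `≥ M + 1` whose class `c_M` has order
  `≥ 2^{M-d₀}` (Kolyvagin: `m_f < ∞ ⇒ ∀ n' > m_f ∃ λ ∈ Λ^f_{n'}, m(λ) = m_f`);
* (T5b) the WINDOW STEP: for one defect `D` and every level `M`, from a depth-`ν` conductor `S`
  whose class has order `≥ 2^{M-e}` and a prime `a ∈ S` to drop, a NEW Kolyvagin prime `q ∉ S`
  of index `≥ M + 1` at which that class has local order `≥ 2^{M-e-D}`, such that the new window
  `(S ∖ {a}) ∪ {q}` carries a class of order `≥ 2^{M-e-D}` (Čebotarev with prescribed local order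
  + Kolyvagin's relation + global duality — the research content at `2`).

`exists_windows_of_step` is the pure combinatorics (no Heegner points): windows are bundles
`⟨S, datum⟩`; at stage `k < ν` one drops an element of the current window different from the `k`
test primes already placed in it, so the incidences `q_j ∈ S_i` (`j < i`) persist; a last
application supplies the test prime of the final window.
`windowSupply_of_strongNonvanishing_of_windowStep` instantiates it: its conclusion is the
registered signature of `stub_windowSupply` verbatim, its two hypotheses are (T5a), (T5b).
HONEST FRAMING: (T5a) and (T5b) at the prime `2` are NOT proved here or anywhere in print
(Kolyvagin asserts the `ℓ ∉ B(E)` theory "with modifications", p. 259); this file only reduces T5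
to them; BSD is not proved; V2♭ stays open.
-/

set_option autoImplicit false
-- the Theorems namespace of this sub repeats the summit name by design (D-0017 nested layout)
set_option linter.dupNamespace false

noncomputable section

open scoped Classical

open WeierstrassCurve Literature.NumberTheory.EllipticCurves
  Literature.NumberTheory.EllipticCurves.ModularForms NumberField IsDedekindDomain
open Summit.BirchSwinnertonDyer.BirchSwinnertonDyer.Theses.KolyvaginRankRigidityAtTwo

namespace Summit.BirchSwinnertonDyer.BirchSwinnertonDyer.Theorems.KolyvaginLowerBoundAtTwo

universe u

/-! ## The abstract window induction -/

section Abstract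

variable {Dat : Finset ℕ → Type u}

/-- **Kolyvagin's window induction, abstract form.** Windows are bundles `b = ⟨S, datum⟩`
(`S` a `ν`-set of admissible primes), `Ord k b` = "`b` is good at stage `k`", `Loc b q` = "the
prime `q` tests `b`". Suppose a good start window and a STEP: from a good window `b` at stage
`k ≤ ν` and any `a ∈ S`, a new admissible `q ∉ S` testing `b`, with the window
`insert q (S.erase a)` good at stage `k + 1`. Then there are windows `b_0, …, b_ν` and test primes
`q_0, …, q_ν` with `q_j ∈ S_i` for `j < i` and `Loc b_i q_i` for all `i` (Kolyvagin 1991, proof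
of Thm. 2.2: `S_i = {p_i, …, p_{i+ν-1}}`, `q_j = p_{ν+j}`; here at stage `k < ν` the dropped
element is chosen outside the `k` test primes already in the window).
[cite: Kolyvagin1991MathAnn, §2, proof of Thm. 2.2] -/
theorem exists_windows_of_step (ν : ℕ) (hν : 1 ≤ ν) (Adm : ℕ → Prop)
    (Ord : ℕ → (Σ S : Finset ℕ, Dat S) → Prop) (Loc : (Σ S : Finset ℕ, Dat S) → ℕ → Prop)
    (h0 : ∃ b : Σ S : Finset ℕ, Dat S, b.1.card = ν ∧ (∀ p ∈ b.1, Adm p) ∧ Ord 0 b)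
    (hstep : ∀ (k : ℕ) (b : Σ S : Finset ℕ, Dat S) (a : ℕ), k ≤ ν → b.1.card = ν →
      (∀ p ∈ b.1, Adm p) → a ∈ b.1 → Ord k b →
      ∃ q : ℕ, q ∉ b.1 ∧ Adm q ∧ Loc b q ∧
        ∃ d' : Dat (insert q (b.1.erase a)), Ord (k + 1) ⟨insert q (b.1.erase a), d'⟩) :
    ∃ (b : Fin (ν + 1) → Σ S : Finset ℕ, Dat S) (q : Fin (ν + 1) → ℕ),
      (∀ i, (b i).1.card = ν) ∧ (∀ i, ∀ p ∈ (b i).1, Adm p) ∧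
      (∀ i j : Fin (ν + 1), j < i → q j ∈ (b i).1) ∧ (∀ i, Loc (b i) (q i)) := by
  -- Claim(k): windows `b_0..b_k`, tests `q_0..q_{k-1}`
  have claim : ∀ k : ℕ, k ≤ ν →
      ∃ (b : Fin (k + 1) → Σ S : Finset ℕ, Dat S) (q : Fin k → ℕ),
        (∀ i, (b i).1.card = ν ∧ ∀ p ∈ (b i).1, Adm p) ∧
        (∀ (i : Fin (k + 1)) (j : Fin k), (j : ℕ) < (i : ℕ) → q j ∈ (b i).1) ∧
        (∀ j : Fin k, Loc (b (Fin.castSucc j)) (q j)) ∧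
        Ord k (b (Fin.last k)) := by
    intro k
    induction k with
    | zero =>
      intro _
      obtain ⟨b₀, hc, hA, hO⟩ := h0
      exact ⟨fun _ ↦ b₀, Fin.elim0, fun _ ↦ ⟨hc, hA⟩, fun _ j ↦ j.elim0, fun j ↦ j.elim0, hO⟩
    | succ k ih =>
      intro hk
      obtain ⟨b, q, hcA, hinc, hloc, hord⟩ := ih (Nat.le_of_succ_le hk)
      -- drop an element of the last window which is not one of the test primes placed in it
      have hcard_img : (Finset.univ.image q).card < (b (Fin.last k)).1.card := by
        calc (Finset.univ.image q).card ≤ (Finset.univ : Finset (Fin k)).card :=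
              Finset.card_image_le
          _ = k := Finset.card_fin k
          _ < ν := hk
          _ = (b (Fin.last k)).1.card := (hcA _).1.symm
      obtain ⟨a, ha, hanot⟩ := Finset.exists_mem_notMem_of_card_lt_card hcard_img
      obtain ⟨q₀, hq₀S, hq₀A, hq₀L, d', hO'⟩ :=
        hstep k (b (Fin.last k)) a (Nat.le_of_succ_le hk) (hcA _).1 (hcA _).2 ha hord
      refine ⟨Fin.snoc b ⟨insert q₀ ((b (Fin.last k)).1.erase a), d'⟩, Fin.snoc q q₀,
        ?_, ?_, ?_, ?_⟩
      · -- cardinality and admissibility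
        intro i
        rcases Fin.eq_castSucc_or_eq_last i with ⟨i', rfl⟩ | rfl
        · rw [Fin.snoc_castSucc]; exact hcA i'
        · rw [Fin.snoc_last]
          refine ⟨?_, fun p hp ↦ ?_⟩
          · change (insert q₀ ((b (Fin.last k)).1.erase a)).card = ν
            rw [Finset.card_insert_of_notMem (fun h ↦ hq₀S (Finset.mem_of_mem_erase h)),
              Finset.card_erase_of_mem ha, (hcA _).1]
            omega
          · change p ∈ insert q₀ ((b (Fin.last k)).1.erase a) at hp
            rcases Finset.mem_insert.mp hp with rfl | hp'
            · exact hq₀A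
            · exact (hcA _).2 p (Finset.mem_of_mem_erase hp')
      · -- incidences
        intro i j hji
        rcases Fin.eq_castSucc_or_eq_last i with ⟨i', rfl⟩ | rfl
        · -- an old window: `j < i' ≤ k`, so `j` is an old test prime
          rw [Fin.snoc_castSucc]
          rcases Fin.eq_castSucc_or_eq_last j with ⟨j', rfl⟩ | rfl
          · rw [Fin.snoc_castSucc]
            exact hinc i' j' (by simpa using hji)
          · exfalso
            have h1 := i'.is_lt
            simp only [Fin.val_castSucc, Fin.val_last] at hji
            omega
        · -- the new window
          rw [Fin.snoc_last]
          rcases Fin.eq_castSucc_or_eq_last j with ⟨j', rfl⟩ | rfl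
          · rw [Fin.snoc_castSucc]
            change q j' ∈ insert q₀ ((b (Fin.last k)).1.erase a)
            have hmem : q j' ∈ (b (Fin.last k)).1 :=
              hinc (Fin.last k) j' (by rw [Fin.val_last]; exact j'.is_lt)
            have hne : q j' ≠ a := fun h ↦
              hanot (Finset.mem_image.mpr ⟨j', Finset.mem_univ _, h⟩)
            exact Finset.mem_insert_of_mem (Finset.mem_erase.mpr ⟨hne, hmem⟩)
          · rw [Fin.snoc_last]
            exact Finset.mem_insert_self _ _
      · -- local tests
        intro j
        rcases Fin.eq_castSucc_or_eq_last j with ⟨j', rfl⟩ | rfl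
        · simp only [Fin.snoc_castSucc]
          exact hloc j'
        · rw [Fin.snoc_last, Fin.snoc_castSucc]
          exact hq₀L
      · -- the new window is good at stage `k + 1`
        rw [Fin.snoc_last]
        exact hO'
  -- the windows of stage `ν`, plus one more test prime for the last window
  obtain ⟨b, q, hcA, hinc, hloc, hord⟩ := claim ν le_rfl
  obtain ⟨a, ha⟩ : (b (Fin.last ν)).1.Nonempty := by
    rw [← Finset.card_pos, (hcA _).1]; exact hν
  obtain ⟨q₀, -, -, hq₀L, -⟩ := hstep ν (b (Fin.last ν)) a le_rfl (hcA _).1 (hcA _).2 ha hord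
  refine ⟨b, Fin.snoc q q₀, fun i ↦ (hcA i).1, fun i ↦ (hcA i).2, ?_, ?_⟩
  · intro i j hji
    rcases Fin.eq_castSucc_or_eq_last j with ⟨j', rfl⟩ | rfl
    · rw [Fin.snoc_castSucc]
      exact hinc i j' (by simpa [Fin.lt_def] using hji)
    · exact absurd hji (not_lt.mpr (Fin.le_last i))
  · intro i
    rcases Fin.eq_castSucc_or_eq_last i with ⟨i', rfl⟩ | rfl
    · rw [Fin.snoc_castSucc]
      exact hloc i'
    · rw [Fin.snoc_last]
      exact hq₀L

end Abstract

/-! ## T5 from (T5a) strong non-vanishing and (T5b) the window step -/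

/-- **Kolyvagin's window supply (registered stub T5 `stub_windowSupply`) from strong
non-vanishing at the minimal depth (T5a) and the one-prime window step (T5b).** Both hypotheses
carry V2♭'s habitat and frame, the minimal depth `ν ≥ 1` (a non-zero class of depth `ν`, all
classes of smaller depth zero), and are stated at each level `M ≥ 1` with Kolyvagin primes of
index `≥ M + 1` (margin); orders are spelled `2^e · c ≠ 0` / `2^e · c ∉ ker loc_v` for
`e + (defect) < M`. The conclusion is the registered signature of `stub_windowSupply` verbatim,
with defect `d₀ + (ν + 1) D`. Kolyvagin 1991, proof of Thm. 2.2 ("by means of [1, Proposition 8]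
… by induction"); the two hypotheses at `2` are the research content (not in print).
[cite: Kolyvagin1991MathAnn, §2, proof of Thm. 2.2; p. 259 (ℓ ∉ B(E))] -/
theorem windowSupply_of_strongNonvanishing_of_windowStep
    (h5a : ∀ (W : WeierstrassCurve ℚ) [W.IsElliptic] [W.IsGloballyMinimal], ¬ W.HasCM →
      (Rank1Residual.GoodOrd W 2 ∨ Rank1Residual.Mult W 2) →
      (∀ m : ℕ, W.HasSurjectiveModNGaloisRep (2 ^ m : ℕ)) →
      ∀ (K : Type) [Field K] [NumberField K], IsImaginaryQuadratic K → NumberField.discr K ≠ -3 →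
      NumberField.discr K ≠ -4 → ¬ ((2 : ℤ) ∣ NumberField.discr K) → ∀ [NeZero (W.conductorNorm ℤ)],
      SatisfiesHeegnerHypothesis (W.conductorNorm ℤ) K →
      ∀ (Dt : ModularParametrizationData W (W.conductorNorm ℤ)) (β : ℤ) (ι : K →+* ℂ) (ν : ℕ),
        1 ≤ ν →
        (∃ (n₀ : ℕ) (d₀ : KolyvaginHeegnerData Dt β ι n₀) (M₀ : ℕ),
          KolyvaginDescent.KolSupp (Zhang2014.IsKolyvaginPrime (W.conductorNorm ℤ) W K 2) n₀ ∧
          n₀.primeFactors.card = ν ∧ 1 ≤ M₀ ∧ (M₀ : ℕ∞) ≤ Zhang2014.levelIndex W 2 n₀ ∧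
          d₀.kolyvaginClass Nat.prime_two M₀ ≠ 0) →
        (∀ (n' : ℕ) (d' : KolyvaginHeegnerData Dt β ι n') (M' : ℕ),
          KolyvaginDescent.KolSupp (Zhang2014.IsKolyvaginPrime (W.conductorNorm ℤ) W K 2) n' →
          1 ≤ M' → (M' : ℕ∞) ≤ Zhang2014.levelIndex W 2 n' → n'.primeFactors.card < ν →
          d'.kolyvaginClass Nat.prime_two M' = 0) →
        ∃ d0 : ℕ, ∀ M : ℕ, 1 ≤ M →
          ∃ (S : Finset ℕ) (dat : KolyvaginHeegnerData Dt β ι (∏ p ∈ S, p)),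
            S.card = ν ∧
            (∀ p ∈ S, Zhang2014.IsKolyvaginPrime (W.conductorNorm ℤ) W K 2 p ∧
              M + 1 ≤ Zhang2014.kolyvaginIndex W 2 p) ∧
            ∀ e : ℕ, e + d0 < M → ((2 ^ e : ℕ) : ℤ) • dat.kolyvaginClass Nat.prime_two M ≠ 0)
    (h5b : ∀ (W : WeierstrassCurve ℚ) [W.IsElliptic] [W.IsGloballyMinimal], ¬ W.HasCM →
      (Rank1Residual.GoodOrd W 2 ∨ Rank1Residual.Mult W 2) →
      (∀ m : ℕ, W.HasSurjectiveModNGaloisRep (2 ^ m : ℕ)) →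
      ∀ (K : Type) [Field K] [NumberField K], IsImaginaryQuadratic K → NumberField.discr K ≠ -3 →
      NumberField.discr K ≠ -4 → ¬ ((2 : ℤ) ∣ NumberField.discr K) → ∀ [NeZero (W.conductorNorm ℤ)],
      SatisfiesHeegnerHypothesis (W.conductorNorm ℤ) K →
      ∀ (Dt : ModularParametrizationData W (W.conductorNorm ℤ)) (β : ℤ) (ι : K →+* ℂ) (ν : ℕ),
        1 ≤ ν →
        (∃ (n₀ : ℕ) (d₀ : KolyvaginHeegnerData Dt β ι n₀) (M₀ : ℕ),
          KolyvaginDescent.KolSupp (Zhang2014.IsKolyvaginPrime (W.conductorNorm ℤ) W K 2) n₀ ∧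
          n₀.primeFactors.card = ν ∧ 1 ≤ M₀ ∧ (M₀ : ℕ∞) ≤ Zhang2014.levelIndex W 2 n₀ ∧
          d₀.kolyvaginClass Nat.prime_two M₀ ≠ 0) →
        (∀ (n' : ℕ) (d' : KolyvaginHeegnerData Dt β ι n') (M' : ℕ),
          KolyvaginDescent.KolSupp (Zhang2014.IsKolyvaginPrime (W.conductorNorm ℤ) W K 2) n' →
          1 ≤ M' → (M' : ℕ∞) ≤ Zhang2014.levelIndex W 2 n' → n'.primeFactors.card < ν →
          d'.kolyvaginClass Nat.prime_two M' = 0) →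
        ∃ D : ℕ, ∀ M : ℕ, 1 ≤ M →
          ∀ (S : Finset ℕ) (dat : KolyvaginHeegnerData Dt β ι (∏ p ∈ S, p)) (a e : ℕ),
            S.card = ν →
            (∀ p ∈ S, Zhang2014.IsKolyvaginPrime (W.conductorNorm ℤ) W K 2 p ∧
              M + 1 ≤ Zhang2014.kolyvaginIndex W 2 p) →
            a ∈ S →
            (∀ e' : ℕ, e' + e < M → ((2 ^ e' : ℕ) : ℤ) • dat.kolyvaginClass Nat.prime_two M ≠ 0) →
            ∃ q : ℕ, q ∉ S ∧ Zhang2014.IsKolyvaginPrime (W.conductorNorm ℤ) W K 2 q ∧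
              M + 1 ≤ Zhang2014.kolyvaginIndex W 2 q ∧
              (∃ v : HeightOneSpectrum (𝓞 K), ((q : ℕ) : 𝓞 K) ∈ v.asIdeal ∧
                ∀ e' : ℕ, e' + e + D < M →
                  ((2 ^ e' : ℕ) : ℤ) • dat.kolyvaginClass Nat.prime_two M ∉
                    (W.baseChange K).torsionLocalKer (v.adicCompletion K) ((2 ^ M : ℕ) : ℤ)) ∧
              ∃ dat' : KolyvaginHeegnerData Dt β ι (∏ p ∈ insert q (S.erase a), p),
                ∀ e' : ℕ, e' + e + D < M →
                  ((2 ^ e' : ℕ) : ℤ) • dat'.kolyvaginClass Nat.prime_two M ≠ 0) :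
    ∀ (W : WeierstrassCurve ℚ) [W.IsElliptic] [W.IsGloballyMinimal], ¬ W.HasCM →
      (Rank1Residual.GoodOrd W 2 ∨ Rank1Residual.Mult W 2) →
      (∀ m : ℕ, W.HasSurjectiveModNGaloisRep (2 ^ m : ℕ)) →
      ∀ (K : Type) [Field K] [NumberField K], IsImaginaryQuadratic K → NumberField.discr K ≠ -3 →
      NumberField.discr K ≠ -4 → ¬ ((2 : ℤ) ∣ NumberField.discr K) → ∀ [NeZero (W.conductorNorm ℤ)],
      SatisfiesHeegnerHypothesis (W.conductorNorm ℤ) K →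
      ∀ (Dt : ModularParametrizationData W (W.conductorNorm ℤ)) (β : ℤ) (ι : K →+* ℂ) (ν : ℕ),
        1 ≤ ν →
        (∃ (n₀ : ℕ) (d₀ : KolyvaginHeegnerData Dt β ι n₀) (M₀ : ℕ),
          KolyvaginDescent.KolSupp (Zhang2014.IsKolyvaginPrime (W.conductorNorm ℤ) W K 2) n₀ ∧
          n₀.primeFactors.card = ν ∧ 1 ≤ M₀ ∧ (M₀ : ℕ∞) ≤ Zhang2014.levelIndex W 2 n₀ ∧
          d₀.kolyvaginClass Nat.prime_two M₀ ≠ 0) →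
        (∀ (n' : ℕ) (d' : KolyvaginHeegnerData Dt β ι n') (M' : ℕ),
          KolyvaginDescent.KolSupp (Zhang2014.IsKolyvaginPrime (W.conductorNorm ℤ) W K 2) n' →
          1 ≤ M' → (M' : ℕ∞) ≤ Zhang2014.levelIndex W 2 n' → n'.primeFactors.card < ν →
          d'.kolyvaginClass Nat.prime_two M' = 0) →
        ∃ dd : ℕ, ∀ M : ℕ, 1 ≤ M →
          ∃ (S : Fin (ν + 1) → Finset ℕ) (q : Fin (ν + 1) → ℕ)
            (v : Fin (ν + 1) → HeightOneSpectrum (𝓞 K))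
            (dat : (i : Fin (ν + 1)) → KolyvaginHeegnerData Dt β ι (∏ p ∈ S i, p)),
            (∀ i, (S i).card = ν) ∧
            (∀ i, ∀ p ∈ S i, Zhang2014.IsKolyvaginPrime (W.conductorNorm ℤ) W K 2 p ∧
              M + 1 ≤ Zhang2014.kolyvaginIndex W 2 p) ∧
            (∀ i j : Fin (ν + 1), j < i → q j ∈ S i) ∧
            (∀ i, ((q i : ℕ) : 𝓞 K) ∈ (v i).asIdeal) ∧
            (∀ (i : Fin (ν + 1)) (e : ℕ), e + dd < M →
              ((2 ^ e : ℕ) : ℤ) • (dat i).kolyvaginClass Nat.prime_two M ∉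
                (W.baseChange K).torsionLocalKer ((v i).adicCompletion K) ((2 ^ M : ℕ) : ℤ)) := by
  intro W _ _ hCM hred hsur K _ _ hK hne3 hne4 h2d _ hHN Dt β ι ν hν hwit hmin
  obtain ⟨d0, hA⟩ := h5a W hCM hred hsur K hK hne3 hne4 h2d hHN Dt β ι ν hν hwit hmin
  obtain ⟨D, hB⟩ := h5b W hCM hred hsur K hK hne3 hne4 h2d hHN Dt β ι ν hν hwit hmin
  refine ⟨d0 + (ν + 1) * D, fun M hM ↦ ?_⟩
  set N := W.conductorNorm ℤ with hN
  -- the abstract induction at level `M`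
  obtain ⟨b, q, hcard, hAdm, hinc, hLoc⟩ := exists_windows_of_step
    (Dat := fun S ↦ KolyvaginHeegnerData Dt β ι (∏ p ∈ S, p)) ν hν
    (fun p ↦ Zhang2014.IsKolyvaginPrime N W K 2 p ∧ M + 1 ≤ Zhang2014.kolyvaginIndex W 2 p)
    (fun k b ↦ ∀ e' : ℕ, e' + (d0 + k * D) < M →
      ((2 ^ e' : ℕ) : ℤ) • b.2.kolyvaginClass Nat.prime_two M ≠ 0)
    (fun b q ↦ ∃ v : HeightOneSpectrum (𝓞 K), ((q : ℕ) : 𝓞 K) ∈ v.asIdeal ∧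
      ∀ e' : ℕ, e' + (d0 + (ν + 1) * D) < M →
        ((2 ^ e' : ℕ) : ℤ) • b.2.kolyvaginClass Nat.prime_two M ∉
          (W.baseChange K).torsionLocalKer (v.adicCompletion K) ((2 ^ M : ℕ) : ℤ))
    (by
      obtain ⟨S, dat, hS, hP, hO⟩ := hA M hM
      exact ⟨⟨S, dat⟩, hS, hP, fun e' he' ↦ hO e' (by simpa using he')⟩)
    (by
      intro k b a hk hcard hP ha hO
      obtain ⟨q, hqS, hqK, hqI, ⟨v, hv, hloc⟩, dat', hord'⟩ :=
        hB M hM b.1 b.2 a (d0 + k * D) hcard hP ha hO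
      refine ⟨q, hqS, ⟨hqK, hqI⟩, ⟨v, hv, fun e' he' ↦ hloc e' ?_⟩, dat', fun e' he' ↦ hord' e' ?_⟩
      · have hkD : k * D ≤ ν * D := Nat.mul_le_mul_right _ hk
        have h1 : (ν + 1) * D = ν * D + D := by ring
        rw [h1] at he'
        omega
      · have h1 : (k + 1) * D = k * D + D := by ring
        rw [h1] at he'
        omega)
  choose v hv hvloc using hLoc
  exact ⟨fun i ↦ (b i).1, q, v, fun i ↦ (b i).2, hcard, hAdm, hinc, hv, fun i e he ↦ hvloc i e he⟩

end Summit.BirchSwinnertonDyer.BirchSwinnertonDyer.Theorems.KolyvaginLowerBoundAtTwo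

end
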